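import Literature.Geometry.Lorentzian.DalembertianCompose
import Literature.Geometry.Lorentzian.EnergyCurrents
import HarnessLib

/-!
# Linearity of the covariant Hessian, the wave operator and the gradient square in the function

For a pseudo-Riemannian metric `g` with its Levi-Civita connection and real functions `u, v` of
class `C²` at a point `x` (O'Neill 1983, Ch. 3, Def. 3.48–Lemma 3.49: `H^f = ∇(df)` is
`𝔉(M)`-linear in `f`; Def. 3.50: `Δ = div ∘ grad` is linear):

* `hessianAux_add`, `hessian_add` — `Hess(u + v) = Hess u + Hess v` at `x`;
* `hessian_const_mul` — `Hess(c·u) = c·Hess u` (the composite rule `hessian_real_comp` with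
  `ζ = c·id`); `hessian_add_const_mul` — `Hess(u + s·v) = Hess u + s·Hess v`;
* `dalembertian_add_of_contMDiffAt`, `dalembertian_const_mul_of_contMDiffAt`, `dalembertian_add_const_mul_of_contMDiffAt` — the same for
  `□_g = tr_g Hess`;
* `mvfderiv_add_const_mul_apply` — `d(u + s·v) = du + s·dv`;
* `innerDual_add_smul_self`, `gradSq_add_const_mul` (with `innerDual_comm`) —
  `|d(u + s v)|²_g = |du|²_g + 2s g⁻¹(du, dv) + s²|dv|²_g`.

The tree's `hessian` is the representing bilinear form of the classical formula when one exists
and `0` otherwise, so additivity is only asserted for `C²` data (both summands representable,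
`hessian_apply_holds`); `hessian_neg` (`RicciFlowScalarMaximumPrinciple.lean`) and
`hessian_add_const` (`GradientShrinkerProofs.lean`) are the previously available special cases.
These are the bookkeeping lemmas for differentiating a nonlinear operator built from
`Hess w, dw, Δw` along an affine line `w + s φ` (the linearisation of the Gursky–Viaclovsky path
equation, `GurskyViaclovskyOpennessProofs.lean`). Everything is proved; no definition, no named
fact.

## References

* B. O'Neill, *Semi-Riemannian geometry* (1983), Ch. 3, Def. 3.48–3.50, Lemma 3.49. [ONeill1983]
-/

noncomputable section

open Bundle Set Filter Function FiberBundle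
open scoped Manifold ContDiff Topology

namespace Literature.Geometry.Lorentzian

namespace PseudoRiemannianMetric

variable {E : Type*} [NormedAddCommGroup E] [NormedSpace ℝ E] {H : Type*} [TopologicalSpace H]
  {I : ModelWithCorners ℝ E H} {M : Type*} [TopologicalSpace M] [ChartedSpace H M]
  [IsManifold I ∞ M] {n : ℕ∞ω} [Fact (1 ≤ n)] [FiniteDimensional ℝ E] [CompleteSpace E]
  (g : PseudoRiemannianMetric I n E (TangentSpace I : M → Type _)) [g.HasLeviCivita]

/-! ### The differential -/

omit [IsManifold I ∞ M] [Fact (1 ≤ n)] [FiniteDimensional ℝ E] [CompleteSpace E]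
  [g.HasLeviCivita] in
/-- `d(u + s·v)_x = du_x + s·dv_x` for `u, v` differentiable at `x`. [folklore] -/
theorem mvfderiv_add_const_mul_apply {u v : M → ℝ} {x : M} (hu : MDifferentiableAt I 𝓘(ℝ, ℝ) u x)
    (hv : MDifferentiableAt I 𝓘(ℝ, ℝ) v x) (s : ℝ) (a : TangentSpace I x) :
    mvfderiv I (fun y ↦ u y + s * v y) x a = mvfderiv I u x a + s * mvfderiv I v x a := by
  have hsv : MDifferentiableAt I 𝓘(ℝ, ℝ) (fun y ↦ s * v y) x := by
    have : (fun y ↦ s * v y) = (fun t : ℝ ↦ s * t) ∘ v := rfl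
    rw [this]
    exact ((mdifferentiableAt_iff_differentiableAt.2
      ((differentiableAt_id.const_mul s))).comp x hv :)
  have h1 : mvfderiv I (fun y ↦ u y + s * v y) x = mvfderiv I u x + mvfderiv I (fun y ↦ s * v y) x :=
    mvfderiv_add hu hsv
  have h2 : mvfderiv I (fun y ↦ s * v y) x a = s * mvfderiv I v x a := by
    rw [show (fun y ↦ s * v y) = (fun t : ℝ ↦ s * t) ∘ v from rfl,
      mvfderiv_real_comp (ζ := fun t : ℝ ↦ s * t) ((differentiableAt_id.const_mul s)) hv a]
    simp
  rw [h1, _root_.add_apply, h2]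

/-! ### The Hessian -/

omit [FiniteDimensional ℝ E] [CompleteSpace E] [Fact (1 ≤ n)] in
/-- **The Hessian operation is additive in the function** at points where both functions are
`C²`: `X(Y(u+v)) − (∇_X Y)(u+v) = [X(Yu) − (∇_X Y)u] + [X(Yv) − (∇_X Y)v]` (near `x`,
`d(u+v) = du + dv`). O'Neill 1983, Ch. 3, Lemma 3.49. [cite: ONeill1983, Ch. 3, Lemma 3.49] -/
theorem hessianAux_add {u v : M → ℝ} {x : M} (hu : CMDiffAt 2 u x) (hv : CMDiffAt 2 v x)
    (X : Π y : M, TangentSpace I y) {Y : Π y : M, TangentSpace I y} (hY : MDiffAt (T% Y) x) :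
    g.hessianAux (u + v) X Y x = g.hessianAux u X Y x + g.hessianAux v X Y x := by
  have hu1 : MDifferentiableAt I 𝓘(ℝ, ℝ) u x := hu.mdifferentiableAt (by norm_num)
  have hv1 : MDifferentiableAt I 𝓘(ℝ, ℝ) v x := hv.mdifferentiableAt (by norm_num)
  have huev : ∀ᶠ y in 𝓝 x, MDifferentiableAt I 𝓘(ℝ, ℝ) u y := by
    have h1 : ∀ᶠ y in 𝓝 x, CMDiffAt 2 u y := (contMDiffAt_iff_contMDiffAt_nhds (by simp)).1 hu
    exact h1.mono fun y hy ↦ hy.mdifferentiableAt (by norm_num)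
  have hvev : ∀ᶠ y in 𝓝 x, MDifferentiableAt I 𝓘(ℝ, ℝ) v y := by
    have h1 : ∀ᶠ y in 𝓝 x, CMDiffAt 2 v y := (contMDiffAt_iff_contMDiffAt_nhds (by simp)).1 hv
    exact h1.mono fun y hy ↦ hy.mdifferentiableAt (by norm_num)
  -- the inner function near `x`
  have heq : (fun y ↦ mvfderiv I (u + v) y (Y y)) =ᶠ[𝓝 x]
      fun y ↦ mvfderiv I u y (Y y) + mvfderiv I v y (Y y) := by
    filter_upwards [huev, hvev] with y hy hy'
    rw [mvfderiv_add hy hy']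
    rfl
  have hF : MDifferentiableAt I 𝓘(ℝ, ℝ) (fun y ↦ mvfderiv I u y (Y y)) x :=
    mdifferentiableAt_mvfderiv_apply hu hY
  have hG : MDifferentiableAt I 𝓘(ℝ, ℝ) (fun y ↦ mvfderiv I v y (Y y)) x :=
    mdifferentiableAt_mvfderiv_apply hv hY
  have key := heq.mfderiv_eq (I := I) (I' := 𝓘(ℝ, ℝ))
  have h1 : mvfderiv I (fun y ↦ mvfderiv I (u + v) y (Y y)) x (X x) =
      mvfderiv I (fun y ↦ mvfderiv I u y (Y y) + mvfderiv I v y (Y y)) x (X x) := by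
    change mfderiv I 𝓘(ℝ, ℝ) (fun y ↦ mvfderiv I (u + v) y (Y y)) x (X x) =
      mfderiv I 𝓘(ℝ, ℝ) (fun y ↦ mvfderiv I u y (Y y) + mvfderiv I v y (Y y)) x (X x)
    rw [key]
    rfl
  have h2 : mvfderiv I (fun y ↦ mvfderiv I u y (Y y) + mvfderiv I v y (Y y)) x (X x) =
      mvfderiv I (fun y ↦ mvfderiv I u y (Y y)) x (X x)
        + mvfderiv I (fun y ↦ mvfderiv I v y (Y y)) x (X x) := by
    rw [mvfderiv_fun_add hF hG]
    rfl
  simp only [hessianAux]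
  rw [h1, h2, mvfderiv_add hu1 hv1, _root_.add_apply]
  ring

omit [CompleteSpace E] in
/-- **`Hess(u + v) = Hess u + Hess v`** at a point where `u` and `v` are `C²` (both Hessians and
that of the sum evaluate by the classical formula on extended vectors, `hessian_apply_holds`).
O'Neill 1983, Ch. 3, Lemma 3.49. [cite: ONeill1983, Ch. 3, Lemma 3.49] -/
theorem hessian_add {u v : M → ℝ} {x : M} (hu : CMDiffAt 2 u x) (hv : CMDiffAt 2 v x) :
    g.hessian (u + v) x = g.hessian u x + g.hessian v x := by
  refine LinearMap.ext fun a ↦ LinearMap.ext fun b ↦ ?_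
  set X : Π y : M, TangentSpace I y := FiberBundle.extend E a with hX
  set Y : Π y : M, TangentSpace I y := FiberBundle.extend E b with hY
  have hXd : MDiffAt (T% X) x := mdifferentiableAt_extend ..
  have hYd : MDiffAt (T% Y) x := mdifferentiableAt_extend ..
  have ha : X x = a := by rw [hX, FiberBundle.extend_apply_self]
  have hb : Y x = b := by rw [hY, FiberBundle.extend_apply_self]
  rw [LinearMap.add_apply, LinearMap.add_apply, ← ha, ← hb,
    g.hessian_apply_holds (hu.add hv) hXd hYd, g.hessian_apply_holds hu hXd hYd,
    g.hessian_apply_holds hv hXd hYd, g.hessianAux_add hu hv X hYd]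

omit [CompleteSpace E] in
/-- **`Hess(c·u) = c·Hess u`** at a point where `u` is `C²` (`hessian_real_comp` with
`ζ(t) = c t`, `ζ'' = 0`). O'Neill 1983, Ch. 3, Lemma 3.49. [cite: ONeill1983, Ch. 3, Lemma 3.49] -/
theorem hessian_const_mul {u : M → ℝ} {x : M} (hu : CMDiffAt 2 u x) (c : ℝ) :
    g.hessian (fun y ↦ c * u y) x = c • g.hessian u x := by
  refine LinearMap.ext fun a ↦ LinearMap.ext fun b ↦ ?_
  have hζ : ContDiffAt ℝ 2 (fun t : ℝ ↦ c * t) (u x) := (contDiff_const.mul contDiff_id).contDiffAt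
  have hd1 : deriv (fun t : ℝ ↦ c * t) = fun _ ↦ c := by
    funext t
    simp
  have hd2 : deriv (deriv fun t : ℝ ↦ c * t) (u x) = 0 := by
    rw [hd1, deriv_const]
  have h := g.hessian_real_comp (ζ := fun t : ℝ ↦ c * t) hu hζ a b
  rw [show (fun y ↦ c * u y) = (fun t : ℝ ↦ c * t) ∘ u from rfl, h, hd2, hd1]
  simp only [LinearMap.smul_apply, smul_eq_mul]
  ring

omit [IsManifold I ∞ M] [Fact (1 ≤ n)] [FiniteDimensional ℝ E] [CompleteSpace E]
  [g.HasLeviCivita] in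
/-- `t ↦ s·t` composed with a `C^m` function is `C^m`. [folklore] -/
theorem contMDiffAt_const_mul {v : M → ℝ} {x : M} {m : ℕ∞ω} (hv : CMDiffAt m v x) (s : ℝ) :
    CMDiffAt m (fun y ↦ s * v y) x := by
  have hζ : ContDiff ℝ m (fun t : ℝ ↦ s * t) := contDiff_const.mul contDiff_id
  have h := (contMDiffAt_iff_contDiffAt.2 hζ.contDiffAt).comp x hv
  exact h

omit [IsManifold I ∞ M] [Fact (1 ≤ n)] [FiniteDimensional ℝ E] [CompleteSpace E]
  [g.HasLeviCivita] in
/-- `C^m` functions are stable under `u + s·v`. [folklore] -/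
theorem contMDiffAt_add_const_mul {u v : M → ℝ} {x : M} {m : ℕ∞ω} (hu : CMDiffAt m u x)
    (hv : CMDiffAt m v x) (s : ℝ) : CMDiffAt m (fun y ↦ u y + s * v y) x :=
  hu.add (contMDiffAt_const_mul hv s)

omit [CompleteSpace E] in
/-- **`Hess(u + s·v) = Hess u + s·Hess v`** at a point where `u, v` are `C²` — the Hessian along
an affine line of functions. [cite: ONeill1983, Ch. 3, Lemma 3.49] -/
theorem hessian_add_const_mul {u v : M → ℝ} {x : M} (hu : CMDiffAt 2 u x) (hv : CMDiffAt 2 v x)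
    (s : ℝ) : g.hessian (fun y ↦ u y + s * v y) x = g.hessian u x + s • g.hessian v x := by
  have hsv : CMDiffAt 2 (fun y ↦ s * v y) x := contMDiffAt_const_mul hv s
  have h := g.hessian_add hu hsv
  rw [show (u + fun y ↦ s * v y) = fun y ↦ u y + s * v y from rfl] at h
  rw [h, g.hessian_const_mul hv s]

/-! ### The wave operator -/

omit [CompleteSpace E] in
/-- **`□_g(u + v) = □_g u + □_g v`** at a point where `u, v` are `C²` (trace of `hessian_add`).
O'Neill 1983, Ch. 3, Def. 3.50. [cite: ONeill1983, Ch. 3, Def. 3.50] -/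
theorem dalembertian_add_of_contMDiffAt {u v : M → ℝ} {x : M} (hu : CMDiffAt 2 u x) (hv : CMDiffAt 2 v x) :
    g.dalembertian (u + v) x = g.dalembertian u x + g.dalembertian v x := by
  simp only [dalembertian, g.hessian_add hu hv, trace_add]

omit [CompleteSpace E] in
/-- **`□_g(c·u) = c·□_g u`** at a point where `u` is `C²`. [cite: ONeill1983, Ch. 3, Def. 3.50] -/
theorem dalembertian_const_mul_of_contMDiffAt {u : M → ℝ} {x : M} (hu : CMDiffAt 2 u x) (c : ℝ) :
    g.dalembertian (fun y ↦ c * u y) x = c * g.dalembertian u x := by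
  simp only [dalembertian, g.hessian_const_mul hu c, trace_smul]

omit [CompleteSpace E] in
/-- **`□_g(u + s·v) = □_g u + s·□_g v`** at a point where `u, v` are `C²`.
[cite: ONeill1983, Ch. 3, Def. 3.50] -/
theorem dalembertian_add_const_mul_of_contMDiffAt {u v : M → ℝ} {x : M} (hu : CMDiffAt 2 u x)
    (hv : CMDiffAt 2 v x) (s : ℝ) :
    g.dalembertian (fun y ↦ u y + s * v y) x = g.dalembertian u x + s * g.dalembertian v x := by
  simp only [dalembertian, g.hessian_add_const_mul hu hv s, trace_add, trace_smul]

/-! ### The gradient square -/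

omit [Fact (1 ≤ n)] [CompleteSpace E] [g.HasLeviCivita] in
/-- Expansion of `g⁻¹(α + s β, α + s β)` (bilinearity and symmetry `innerDual_comm`). [folklore] -/
theorem innerDual_add_smul_self (x : M) (α β : Module.Dual ℝ (TangentSpace I x)) (s : ℝ) :
    g.innerDual x (α + s • β) (α + s • β) =
      g.innerDual x α α + 2 * s * g.innerDual x α β + s ^ 2 * g.innerDual x β β := by
  have hcomm : β (g.sharp x α) = α (g.sharp x β) := g.innerDual_comm x β α
  simp only [innerDual, map_add, map_smul, LinearMap.add_apply, LinearMap.smul_apply,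
    smul_eq_mul, hcomm]
  ring

omit [Fact (1 ≤ n)] [CompleteSpace E] [g.HasLeviCivita] in
/-- **`|d(u + s v)|²_g = |du|²_g + 2s g⁻¹(du, dv) + s²|dv|²_g`** at a point where `u, v` are
differentiable. [folklore] -/
theorem gradSq_add_const_mul {u v : M → ℝ} {x : M} (hu : MDifferentiableAt I 𝓘(ℝ, ℝ) u x)
    (hv : MDifferentiableAt I 𝓘(ℝ, ℝ) v x) (s : ℝ) :
    g.gradSq (fun y ↦ u y + s * v y) x =
      g.gradSq u x
        + 2 * s * g.innerDual x (mvfderiv I u x).toLinearMap (mvfderiv I v x).toLinearMap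
        + s ^ 2 * g.gradSq v x := by
  have hd : (mvfderiv I (fun y ↦ u y + s * v y) x).toLinearMap =
      (mvfderiv I u x).toLinearMap + s • (mvfderiv I v x).toLinearMap := by
    refine LinearMap.ext fun a ↦ ?_
    simp only [ContinuousLinearMap.coe_coe, LinearMap.add_apply, LinearMap.smul_apply,
      smul_eq_mul, mvfderiv_add_const_mul_apply hu hv s a]
  simp only [gradSq]
  rw [hd, g.innerDual_add_smul_self]

end PseudoRiemannianMetric

end Literature.Geometry.Lorentzian

end
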